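import Summits.ValiantsHypothesis.ValiantsHypothesis.Theorems.LacunarySymmetroidMatrixDescartesCensusDoorA34NodeForm

/-!
# `MatrixDescartes` census — DOOR A at `(3,4)`: NODE CHAMBERS for the COMPLEX-node classes R2 and R0 — the type law at a
# det-root from two explicit test vectors, and the semidefinite law for two real nodes of the same sign

HONEST FRAMING.  Object-search cell `pub-symmetroid`, door-A seat `val-sym-door-p3` (g9); item stmt-ValiantsHypothesis-19980
`DoorA34 = PosRootLawAt 3 4 18` (route item `Theses.LacunarySymmetroid.DoorA34`) is OPEN and asserted nowhere in this file.
Companion of `…CensusDoorA34NodeChambers` (class R4: four real nodes, TYPE = parity of the node sign vector) and of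
`…CensusDoorA34NodeFormComplex` (the determinant in the classes R2 / R0).  A real member of the span of a conjugate pair of nodes
`w wᵀ, w̄ w̄ᵀ` (`w = r + i s`) is `N = m_R (rrᵀ − ssᵀ) − m_I (rsᵀ + srᵀ)`, a form of signature `(1,1)` with kernel line `r × s`;
at each `t` it splits as a difference of two real rank-one squares whose directions ROTATE with `arg m(t)`, so the R4 chamber law
applies instant by instant.  This file records the consequences in a form that needs no square roots — two EXPLICIT test vectors:

* abstract cores: `not_posSemidef_of_testValues` (two test values of opposite sign ⇒ `xᵀMx` takes both signs ⇒ neither `M`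
  nor `−M` is `⪰ 0`) and `posSemidef_of_pairForm` (the square-root-free semidefiniteness argument below).
* class R2, `M = ℓ₀ v₀v₀ᵀ + ℓ₁ v₁v₁ᵀ + N`: `quadForm_R2`, `det_R2_eq` : `det M = ℓ₀ℓ₁·Q(v₀×v₁) − (m_R²+m_I²)·Q(r×s)` with
  `Q(v₀×v₁) = m_R(D_r² − D_s²) − 2m_I D_r D_s` (`D_r = det(v₀;v₁;r)`, `D_s = det(v₀;v₁;s)`) and `Q(r×s) = ℓ₀D₀² + ℓ₁D₁²`
  (`Dᵢ = det(vᵢ;r;s)`).  **`indefinite_R2_of_opposite_realNodes`**: at a det-root with `ℓ₀ℓ₁ < 0` (`m ≠ 0`, `ℓ₀D₀² + ℓ₁D₁² ≠ 0`) the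
  two test values have OPPOSITE strict signs: neither `M` nor `−M` is `⪰ 0`, a MIDDLE-eigenvalue crossing.
  **`posSemidef_R2_of_pos_realNodes`** / `neg_posSemidef_R2_of_neg_realNodes`: at a det-root with `ℓ₀ℓ₁ > 0` (`m ≠ 0`,
  `ℓ₀D₀² + ℓ₁D₁² ≠ 0`) the matrix is semidefinite (a `λ_min` / `λ_max` crossing).  So in class R2 the TYPE of a root is the sign of
  `ℓ₀ℓ₁`, the product of the two REAL node nomials.
* class R0, `M = N(ℓ; p,q) + N(m; r,s)`: `quadForm_R0`, `det_R0_eq` : `det M = −(m_R²+m_I²)·Q(r×s) − (ℓ_R²+ℓ_I²)·Q(p×q)`, and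
  **`indefinite_R0`**: at every det-root (`ℓ, m ≠ 0`, `Q(p×q) ≠ 0`) the two test values have opposite strict signs — in class R0
  EVERY root is a middle-eigenvalue crossing.

Located reading (seat numerics `HOME/val-sym-door-p3/g9/`, not a theorem): the 31 R2 / 2 R0 box-regime census seventeens obey
this law root by root (R0: 17/17 middle; `E3-CAL17` on `(0,1,4,40)`: 14 middle + 3 semidefinite roots = the three roots with
`ℓ₀, ℓ₁ > 0`).  Nothing here bounds `ζ_sym(3,4)`; `DoorA34` stays OPEN; nothing on `MatrixDescartes` (18050) / `VP ≠ VNP`.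
[folklore] Sylvester inertia for sums of rank-one forms; elementary polynomial identities (`Matrix.det_fin_three` + `ring`).
-/

-- `Summit.ValiantsHypothesis.ValiantsHypothesis.…` repeats a component by the D-0017 layout
-- (single-conjunct summit), which the `dupNamespace` linter flags; the name is mandated.
set_option linter.dupNamespace false

namespace Summit.ValiantsHypothesis.ValiantsHypothesis.Theorems.LacunarySymmetroidMatrixDescartes.Census

open Finset
open scoped BigOperators Matrix

/-! ## Test vectors: the cross product written out -/

/-- `a · (a × b) = 0`. [folklore] -/
theorem dotProduct_cross_left (a b : Fin 3 → ℝ) :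
    a ⬝ᵥ (![a 1 * b 2 - a 2 * b 1, a 2 * b 0 - a 0 * b 2, a 0 * b 1 - a 1 * b 0] : Fin 3 → ℝ) = 0 := by
  simp [dotProduct, Fin.sum_univ_three]; ring

/-- `b · (a × b) = 0`. [folklore] -/
theorem dotProduct_cross_right (a b : Fin 3 → ℝ) :
    b ⬝ᵥ (![a 1 * b 2 - a 2 * b 1, a 2 * b 0 - a 0 * b 2, a 0 * b 1 - a 1 * b 0] : Fin 3 → ℝ) = 0 := by
  simp [dotProduct, Fin.sum_univ_three]; ring

/-- `c · (a × b) = det(a;b;c)` (rows), written out by cofactors along `a`. [folklore] -/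
theorem dotProduct_cross_third (a b c : Fin 3 → ℝ) :
    c ⬝ᵥ (![a 1 * b 2 - a 2 * b 1, a 2 * b 0 - a 0 * b 2, a 0 * b 1 - a 1 * b 0] : Fin 3 → ℝ)
      = a 0 * (b 1 * c 2 - b 2 * c 1) - a 1 * (b 0 * c 2 - b 2 * c 0) + a 2 * (b 0 * c 1 - b 1 * c 0) := by
  simp [dotProduct, Fin.sum_univ_three]; ring

/-- The cofactor expression is the determinant of the matrix with rows `a, b, c`. [folklore] -/
theorem cofactor_eq_det_rows (a b c : Fin 3 → ℝ) :
    a 0 * (b 1 * c 2 - b 2 * c 1) - a 1 * (b 0 * c 2 - b 2 * c 0) + a 2 * (b 0 * c 1 - b 1 * c 0)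
      = (Matrix.of ![a, b, c]).det := by
  rw [Matrix.det_fin_three]
  simp only [Matrix.of_apply, Matrix.cons_val_zero, Matrix.cons_val_one, Matrix.head_cons, Matrix.cons_val_two,
    Matrix.tail_cons]
  ring

/-- Three independent vectors (`det(a;b;c) ≠ 0`) have no common non-zero orthogonal vector. [folklore] -/
theorem eq_zero_of_dotProduct_three (a b c x : Fin 3 → ℝ) (hD : (Matrix.of ![a, b, c]).det ≠ 0)
    (ha : a ⬝ᵥ x = 0) (hb : b ⬝ᵥ x = 0) (hc : c ⬝ᵥ x = 0) : x = 0 := by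
  by_contra hne
  refine hD (Matrix.exists_mulVec_eq_zero_iff.mp ⟨x, hne, ?_⟩)
  ext i
  fin_cases i
  · simpa [Matrix.mulVec] using ha
  · simpa [Matrix.mulVec] using hb
  · simpa [Matrix.mulVec] using hc

/-! ## Abstract cores: two test values of opposite sign; the pair-form argument -/

/-- Sign bookkeeping: `a·Qₙ = c·Q_z` with `a < 0 < c` and `Q_z ≠ 0` forces `Qₙ·Q_z < 0`. [folklore] -/
theorem mul_neg_of_eq_of_neg_of_pos {a c Qn Qz : ℝ} (ha : a < 0) (hc : 0 < c) (hz : Qz ≠ 0) (hid : a * Qn = c * Qz) :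
    Qn * Qz < 0 := by
  rcases lt_or_gt_of_ne hz with h | h
  · nlinarith [mul_neg_of_pos_of_neg hc h]
  · nlinarith [mul_pos hc h]

/-- **Two test values of opposite sign ⇒ indefinite.**  If `xᵀMx` is `Qₙ` at `n` and `Q_z` at `z` with `Qₙ·Q_z < 0`, then `xᵀMx`
takes both strict signs and neither `M` nor `−M` is positive semidefinite. [folklore] -/
theorem not_posSemidef_of_testValues {M : Matrix (Fin 3) (Fin 3) ℝ} (n z : Fin 3 → ℝ) {Qn Qz : ℝ}
    (hQn : n ⬝ᵥ (M *ᵥ n) = Qn) (hQz : z ⬝ᵥ (M *ᵥ z) = Qz) (hprod : Qn * Qz < 0) :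
    ((∃ x : Fin 3 → ℝ, x ⬝ᵥ (M *ᵥ x) < 0) ∧ (∃ x : Fin 3 → ℝ, 0 < x ⬝ᵥ (M *ᵥ x))) ∧
      (¬ M.PosSemidef ∧ ¬ (-M).PosSemidef) := by
  have hboth : (∃ x : Fin 3 → ℝ, x ⬝ᵥ (M *ᵥ x) < 0) ∧ (∃ x : Fin 3 → ℝ, 0 < x ⬝ᵥ (M *ᵥ x)) := by
    rcases lt_or_ge Qn 0 with hn | hn
    · have hz : 0 < Qz := by nlinarith
      exact ⟨⟨n, by rw [hQn]; exact hn⟩, ⟨z, by rw [hQz]; exact hz⟩⟩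
    · have hn' : 0 < Qn := by
        rcases lt_or_eq_of_le hn with h | h
        · exact h
        · rw [← h, zero_mul] at hprod; exact absurd hprod (lt_irrefl 0)
      have hz : Qz < 0 := by nlinarith
      exact ⟨⟨z, by rw [hQz]; exact hz⟩, ⟨n, by rw [hQn]; exact hn'⟩⟩
  refine ⟨hboth, ?_, ?_⟩
  · intro hpsd
    obtain ⟨x, hx⟩ := hboth.1
    have h := hpsd.dotProduct_mulVec_nonneg x
    rw [star_trivial] at h
    exact absurd hx (not_lt.mpr h)
  · intro hpsd
    obtain ⟨x, hx⟩ := hboth.2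
    have h := hpsd.dotProduct_mulVec_nonneg x
    rw [star_trivial, Matrix.neg_mulVec, dotProduct_neg] at h
    exact absurd hx (not_lt.mpr (neg_nonneg.mp h))

/-- **Pair-form core (class R2, same-sign real nodes).**  Let `M` be real symmetric `3 × 3` with
`xᵀMx = ℓ₀(v₀·x)² + ℓ₁(v₁·x)² + m_R((r·x)² − (s·x)²) − 2 m_I (r·x)(s·x)`, `ℓ₀, ℓ₁ > 0`, `m ≠ 0`, and `v₀,r,s` or `v₁,r,s` independent.
If `det M = 0` then `M ⪰ 0`.  (No square roots: if `xᵀMx < 0`, the plane through `x` and a kernel vector carries only values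
`β² xᵀMx ≤ 0`; either it maps onto the `(r·y, s·y)`-plane, where the pair form `m_R(a²−b²) − 2m_I ab` is somewhere positive, or it
contains the kernel line `r × s` of the pair form, where `M` reduces to `ℓ₀(v₀·y)² + ℓ₁(v₁·y)² > 0`.) [folklore] -/
theorem posSemidef_of_pairForm {M : Matrix (Fin 3) (Fin 3) ℝ} (hMh : M.IsHermitian) (v₀ v₁ r s : Fin 3 → ℝ)
    (ℓ₀ ℓ₁ mR mI : ℝ)
    (hQ : ∀ y, y ⬝ᵥ (M *ᵥ y) = ℓ₀ * (v₀ ⬝ᵥ y) ^ 2 + ℓ₁ * (v₁ ⬝ᵥ y) ^ 2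
      + mR * ((r ⬝ᵥ y) ^ 2 - (s ⬝ᵥ y) ^ 2) - 2 * mI * ((r ⬝ᵥ y) * (s ⬝ᵥ y)))
    (h₀ : 0 < ℓ₀) (h₁ : 0 < ℓ₁) (hm : 0 < mR ^ 2 + mI ^ 2)
    (hD : (Matrix.of ![v₀, r, s]).det ≠ 0 ∨ (Matrix.of ![v₁, r, s]).det ≠ 0) (hdet : M.det = 0) : M.PosSemidef := by
  have hMT : Mᵀ = M := by
    have h := hMh.eq
    rwa [Matrix.conjTranspose_eq_transpose_of_trivial] at h
  refine Matrix.PosSemidef.of_dotProduct_mulVec_nonneg hMh fun x => ?_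
  rw [star_trivial]
  by_contra hneg
  push Not at hneg
  obtain ⟨k, hk0, hMk⟩ := Matrix.exists_mulVec_eq_zero_iff.mpr hdet
  have hkM : ∀ y, k ⬝ᵥ (M *ᵥ y) = 0 := fun y => by
    rw [Matrix.dotProduct_mulVec, ← hMT, Matrix.vecMul_transpose, hMk, zero_dotProduct]
  have hplane : ∀ α β : ℝ, (α • k + β • x) ⬝ᵥ (M *ᵥ (α • k + β • x)) = β ^ 2 * (x ⬝ᵥ (M *ᵥ x)) := fun α β => by
    rw [Matrix.mulVec_add, Matrix.mulVec_smul, Matrix.mulVec_smul, hMk, smul_zero, zero_add, add_dotProduct,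
      smul_dotProduct, smul_dotProduct, dotProduct_smul, dotProduct_smul, hkM x]
    simp only [smul_eq_mul, mul_zero, zero_add]
    ring
  have hle : ∀ α β : ℝ, (α • k + β • x) ⬝ᵥ (M *ᵥ (α • k + β • x)) ≤ 0 := fun α β => by
    rw [hplane]
    exact mul_nonpos_of_nonneg_of_nonpos (sq_nonneg β) hneg.le
  have hlin : ∀ (w : Fin 3 → ℝ) (α β : ℝ), w ⬝ᵥ (α • k + β • x) = α * (w ⬝ᵥ k) + β * (w ⬝ᵥ x) := fun w α β => by
    rw [dotProduct_add, dotProduct_smul, dotProduct_smul, smul_eq_mul, smul_eq_mul]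
  by_cases hΔ0 : (r ⬝ᵥ k) * (s ⬝ᵥ x) - (r ⬝ᵥ x) * (s ⬝ᵥ k) = 0
  · -- the plane contains the kernel line of the pair form
    have e1r : r ⬝ᵥ ((r ⬝ᵥ x) • k + (-(r ⬝ᵥ k)) • x) = 0 := by rw [hlin]; ring
    have e1s : s ⬝ᵥ ((r ⬝ᵥ x) • k + (-(r ⬝ᵥ k)) • x) = 0 := by rw [hlin]; linear_combination (-1 : ℝ) * hΔ0
    have e2r : r ⬝ᵥ ((s ⬝ᵥ x) • k + (-(s ⬝ᵥ k)) • x) = 0 := by rw [hlin]; linear_combination hΔ0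
    have e2s : s ⬝ᵥ ((s ⬝ᵥ x) • k + (-(s ⬝ᵥ k)) • x) = 0 := by rw [hlin]; ring
    have hy1 := hplane (r ⬝ᵥ x) (-(r ⬝ᵥ k))
    have hy2 := hplane (s ⬝ᵥ x) (-(s ⬝ᵥ k))
    rw [hQ, e1r, e1s] at hy1
    rw [hQ, e2r, e2s] at hy2
    have E1 : (r ⬝ᵥ k) ^ 2 * (x ⬝ᵥ (M *ᵥ x)) = ℓ₀ * (v₀ ⬝ᵥ ((r ⬝ᵥ x) • k + (-(r ⬝ᵥ k)) • x)) ^ 2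
        + ℓ₁ * (v₁ ⬝ᵥ ((r ⬝ᵥ x) • k + (-(r ⬝ᵥ k)) • x)) ^ 2 := by linarith [hy1]
    have E2 : (s ⬝ᵥ k) ^ 2 * (x ⬝ᵥ (M *ᵥ x)) = ℓ₀ * (v₀ ⬝ᵥ ((s ⬝ᵥ x) • k + (-(s ⬝ᵥ k)) • x)) ^ 2
        + ℓ₁ * (v₁ ⬝ᵥ ((s ⬝ᵥ x) • k + (-(s ⬝ᵥ k)) • x)) ^ 2 := by linarith [hy2]
    have P1 : 0 ≤ ℓ₀ * (v₀ ⬝ᵥ ((r ⬝ᵥ x) • k + (-(r ⬝ᵥ k)) • x)) ^ 2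
        + ℓ₁ * (v₁ ⬝ᵥ ((r ⬝ᵥ x) • k + (-(r ⬝ᵥ k)) • x)) ^ 2 := by positivity
    have P2 : 0 ≤ ℓ₀ * (v₀ ⬝ᵥ ((s ⬝ᵥ x) • k + (-(s ⬝ᵥ k)) • x)) ^ 2
        + ℓ₁ * (v₁ ⬝ᵥ ((s ⬝ᵥ x) • k + (-(s ⬝ᵥ k)) • x)) ^ 2 := by positivity
    have Z1 : (r ⬝ᵥ k) ^ 2 * (x ⬝ᵥ (M *ᵥ x)) = 0 :=
      le_antisymm (mul_nonpos_of_nonneg_of_nonpos (sq_nonneg _) hneg.le) (by rw [E1]; exact P1)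
    have Z2 : (s ⬝ᵥ k) ^ 2 * (x ⬝ᵥ (M *ᵥ x)) = 0 :=
      le_antisymm (mul_nonpos_of_nonneg_of_nonpos (sq_nonneg _) hneg.le) (by rw [E2]; exact P2)
    have hrk : r ⬝ᵥ k = 0 := by
      rcases mul_eq_zero.mp Z1 with h | h
      · exact (pow_eq_zero_iff two_ne_zero).mp h
      · exact absurd h hneg.ne
    have hsk : s ⬝ᵥ k = 0 := by
      rcases mul_eq_zero.mp Z2 with h | h
      · exact (pow_eq_zero_iff two_ne_zero).mp h
      · exact absurd h hneg.ne
    -- k is in the kernel of M and orthogonal to r, s: then ℓ₀(v₀·k)² + ℓ₁(v₁·k)² = 0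
    have hkk : k ⬝ᵥ (M *ᵥ k) = 0 := by rw [hMk, dotProduct_zero]
    rw [hQ, hrk, hsk] at hkk
    have A0 : 0 ≤ ℓ₀ * (v₀ ⬝ᵥ k) ^ 2 := by positivity
    have A1 : 0 ≤ ℓ₁ * (v₁ ⬝ᵥ k) ^ 2 := by positivity
    have B0 : ℓ₀ * (v₀ ⬝ᵥ k) ^ 2 = 0 := by linarith
    have B1 : ℓ₁ * (v₁ ⬝ᵥ k) ^ 2 = 0 := by linarith
    have hv0k : v₀ ⬝ᵥ k = 0 := by
      rcases mul_eq_zero.mp B0 with h | h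
      · exact absurd h h₀.ne'
      · exact (pow_eq_zero_iff two_ne_zero).mp h
    have hv1k : v₁ ⬝ᵥ k = 0 := by
      rcases mul_eq_zero.mp B1 with h | h
      · exact absurd h h₁.ne'
      · exact (pow_eq_zero_iff two_ne_zero).mp h
    rcases hD with hD | hD
    · exact hk0 (eq_zero_of_dotProduct_three v₀ r s k hD hv0k hrk hsk)
    · exact hk0 (eq_zero_of_dotProduct_three v₁ r s k hD hv1k hrk hsk)
  · -- the plane maps onto the (r·y, s·y)-plane: every pair value (a,b) is realised with total value ≤ 0
    have key : ∀ a b : ℝ, mR * (a ^ 2 - b ^ 2) - 2 * mI * (a * b) ≤ 0 := fun a b => by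
      have hy := hle ((a * (s ⬝ᵥ x) - b * (r ⬝ᵥ x)) / ((r ⬝ᵥ k) * (s ⬝ᵥ x) - (r ⬝ᵥ x) * (s ⬝ᵥ k)))
        ((b * (r ⬝ᵥ k) - a * (s ⬝ᵥ k)) / ((r ⬝ᵥ k) * (s ⬝ᵥ x) - (r ⬝ᵥ x) * (s ⬝ᵥ k)))
      have hya : r ⬝ᵥ (((a * (s ⬝ᵥ x) - b * (r ⬝ᵥ x)) / ((r ⬝ᵥ k) * (s ⬝ᵥ x) - (r ⬝ᵥ x) * (s ⬝ᵥ k))) • k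
          + ((b * (r ⬝ᵥ k) - a * (s ⬝ᵥ k)) / ((r ⬝ᵥ k) * (s ⬝ᵥ x) - (r ⬝ᵥ x) * (s ⬝ᵥ k))) • x) = a := by
        rw [hlin, div_mul_eq_mul_div, div_mul_eq_mul_div, ← add_div, div_eq_iff hΔ0]; ring
      have hyb : s ⬝ᵥ (((a * (s ⬝ᵥ x) - b * (r ⬝ᵥ x)) / ((r ⬝ᵥ k) * (s ⬝ᵥ x) - (r ⬝ᵥ x) * (s ⬝ᵥ k))) • k
          + ((b * (r ⬝ᵥ k) - a * (s ⬝ᵥ k)) / ((r ⬝ᵥ k) * (s ⬝ᵥ x) - (r ⬝ᵥ x) * (s ⬝ᵥ k))) • x) = b := by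
        rw [hlin, div_mul_eq_mul_div, div_mul_eq_mul_div, ← add_div, div_eq_iff hΔ0]; ring
      rw [hQ, hya, hyb] at hy
      have P0 : 0 ≤ ℓ₀ * (v₀ ⬝ᵥ (((a * (s ⬝ᵥ x) - b * (r ⬝ᵥ x)) / ((r ⬝ᵥ k) * (s ⬝ᵥ x) - (r ⬝ᵥ x) * (s ⬝ᵥ k))) • k
          + ((b * (r ⬝ᵥ k) - a * (s ⬝ᵥ k)) / ((r ⬝ᵥ k) * (s ⬝ᵥ x) - (r ⬝ᵥ x) * (s ⬝ᵥ k))) • x)) ^ 2 := by positivity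
      have P1 : 0 ≤ ℓ₁ * (v₁ ⬝ᵥ (((a * (s ⬝ᵥ x) - b * (r ⬝ᵥ x)) / ((r ⬝ᵥ k) * (s ⬝ᵥ x) - (r ⬝ᵥ x) * (s ⬝ᵥ k))) • k
          + ((b * (r ⬝ᵥ k) - a * (s ⬝ᵥ k)) / ((r ⬝ᵥ k) * (s ⬝ᵥ x) - (r ⬝ᵥ x) * (s ⬝ᵥ k))) • x)) ^ 2 := by positivity
      linarith
    have k1 := key 1 0
    have k2 := key 0 1
    have k3 := key 1 1
    have k4 := key 1 (-1)
    norm_num at k1 k2 k3 k4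
    have hmR : mR = 0 := le_antisymm k1 k2
    have hmI : mI = 0 := le_antisymm (by linarith) (by linarith)
    rw [hmR, hmI] at hm
    norm_num at hm

/-! ## Class R2: two real nodes and one conjugate pair -/

/-- The R2 matrix is symmetric. [folklore] -/
theorem isHermitian_R2 (v₀ v₁ r s : Fin 3 → ℝ) (ℓ₀ ℓ₁ mR mI : ℝ) :
    (ℓ₀ • Matrix.vecMulVec v₀ v₀ + ℓ₁ • Matrix.vecMulVec v₁ v₁
        + mR • (Matrix.vecMulVec r r - Matrix.vecMulVec s s) - mI • (Matrix.vecMulVec r s + Matrix.vecMulVec s r)).IsHermitian := by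
  refine Matrix.IsHermitian.ext fun a b => ?_
  simp only [Matrix.add_apply, Matrix.sub_apply, Matrix.smul_apply, Matrix.vecMulVec_apply, smul_eq_mul, star_trivial]
  ring

/-- **Quadratic form, class R2**: `xᵀMx = ℓ₀(v₀·x)² + ℓ₁(v₁·x)² + m_R((r·x)² − (s·x)²) − 2 m_I (r·x)(s·x)`. [folklore] -/
theorem quadForm_R2 (v₀ v₁ r s : Fin 3 → ℝ) (ℓ₀ ℓ₁ mR mI : ℝ) (x : Fin 3 → ℝ) :
    x ⬝ᵥ ((ℓ₀ • Matrix.vecMulVec v₀ v₀ + ℓ₁ • Matrix.vecMulVec v₁ v₁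
        + mR • (Matrix.vecMulVec r r - Matrix.vecMulVec s s) - mI • (Matrix.vecMulVec r s + Matrix.vecMulVec s r)) *ᵥ x)
      = ℓ₀ * (v₀ ⬝ᵥ x) ^ 2 + ℓ₁ * (v₁ ⬝ᵥ x) ^ 2 + mR * ((r ⬝ᵥ x) ^ 2 - (s ⬝ᵥ x) ^ 2) - 2 * mI * ((r ⬝ᵥ x) * (s ⬝ᵥ x)) := by
  simp only [Matrix.mulVec, dotProduct, Matrix.add_apply, Matrix.sub_apply, Matrix.smul_apply, Matrix.vecMulVec_apply,
    smul_eq_mul, Fin.sum_univ_three]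
  ring

/-- **The R2 determinant through the two test values**:
`det M = ℓ₀ℓ₁ · B − (m_R² + m_I²) · (ℓ₀ D₀² + ℓ₁ D₁²)` with `B = m_R (D_r² − D_s²) − 2 m_I D_r D_s`, `D_r = det(v₀;v₁;r)`,
`D_s = det(v₀;v₁;s)`, `Dᵢ = det(vᵢ;r;s)` (cofactor expressions; the identity of `…NodeFormComplex.det_twoReal_oneConjPair`
regrouped). [folklore] -/
theorem det_R2_eq (v₀ v₁ r s : Fin 3 → ℝ) (ℓ₀ ℓ₁ mR mI : ℝ) :
    (ℓ₀ • Matrix.vecMulVec v₀ v₀ + ℓ₁ • Matrix.vecMulVec v₁ v₁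
        + mR • (Matrix.vecMulVec r r - Matrix.vecMulVec s s) - mI • (Matrix.vecMulVec r s + Matrix.vecMulVec s r)).det
      = ℓ₀ * ℓ₁ * (mR * ((v₀ 0 * (v₁ 1 * r 2 - v₁ 2 * r 1) - v₀ 1 * (v₁ 0 * r 2 - v₁ 2 * r 0) + v₀ 2 * (v₁ 0 * r 1 - v₁ 1 * r 0)) ^ 2
              - (v₀ 0 * (v₁ 1 * s 2 - v₁ 2 * s 1) - v₀ 1 * (v₁ 0 * s 2 - v₁ 2 * s 0) + v₀ 2 * (v₁ 0 * s 1 - v₁ 1 * s 0)) ^ 2)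
            - 2 * mI * ((v₀ 0 * (v₁ 1 * r 2 - v₁ 2 * r 1) - v₀ 1 * (v₁ 0 * r 2 - v₁ 2 * r 0) + v₀ 2 * (v₁ 0 * r 1 - v₁ 1 * r 0))
              * (v₀ 0 * (v₁ 1 * s 2 - v₁ 2 * s 1) - v₀ 1 * (v₁ 0 * s 2 - v₁ 2 * s 0) + v₀ 2 * (v₁ 0 * s 1 - v₁ 1 * s 0))))
        - (mR ^ 2 + mI ^ 2) *
          (ℓ₀ * (v₀ 0 * (r 1 * s 2 - r 2 * s 1) - v₀ 1 * (r 0 * s 2 - r 2 * s 0) + v₀ 2 * (r 0 * s 1 - r 1 * s 0)) ^ 2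
            + ℓ₁ * (v₁ 0 * (r 1 * s 2 - r 2 * s 1) - v₁ 1 * (r 0 * s 2 - r 2 * s 0) + v₁ 2 * (r 0 * s 1 - r 1 * s 0)) ^ 2) := by
  rw [Matrix.det_fin_three]
  simp only [Matrix.add_apply, Matrix.sub_apply, Matrix.smul_apply, Matrix.vecMulVec_apply, smul_eq_mul]
  ring

/-- **Class R2, opposite real nodes ⇒ INDEFINITE type.**  `M = ℓ₀ v₀v₀ᵀ + ℓ₁ v₁v₁ᵀ + m_R (rrᵀ − ssᵀ) − m_I (rsᵀ + srᵀ)` with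
`ℓ₀ ℓ₁ < 0`, `m ≠ 0`, and the generic condition `ℓ₀ D₀² + ℓ₁ D₁² ≠ 0` (`Dᵢ = det(vᵢ;r;s)`).  If `det M = 0` then `xᵀMx` is strictly
negative at one of the test vectors `v₀ × v₁`, `r × s` and strictly positive at the other; neither `M` nor `−M` is positive
semidefinite: along a class-R2 pencil, a det-root met while the two REAL node nomials have opposite signs is a middle-eigenvalue
crossing. [folklore] -/
theorem indefinite_R2_of_opposite_realNodes (v₀ v₁ r s : Fin 3 → ℝ) (ℓ₀ ℓ₁ mR mI : ℝ) (hℓ : ℓ₀ * ℓ₁ < 0)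
    (hm : 0 < mR ^ 2 + mI ^ 2)
    (hz : ℓ₀ * (v₀ 0 * (r 1 * s 2 - r 2 * s 1) - v₀ 1 * (r 0 * s 2 - r 2 * s 0) + v₀ 2 * (r 0 * s 1 - r 1 * s 0)) ^ 2
            + ℓ₁ * (v₁ 0 * (r 1 * s 2 - r 2 * s 1) - v₁ 1 * (r 0 * s 2 - r 2 * s 0) + v₁ 2 * (r 0 * s 1 - r 1 * s 0)) ^ 2 ≠ 0)
    (hdet : (ℓ₀ • Matrix.vecMulVec v₀ v₀ + ℓ₁ • Matrix.vecMulVec v₁ v₁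
        + mR • (Matrix.vecMulVec r r - Matrix.vecMulVec s s) - mI • (Matrix.vecMulVec r s + Matrix.vecMulVec s r)).det = 0) :
    ((∃ x : Fin 3 → ℝ, x ⬝ᵥ ((ℓ₀ • Matrix.vecMulVec v₀ v₀ + ℓ₁ • Matrix.vecMulVec v₁ v₁
        + mR • (Matrix.vecMulVec r r - Matrix.vecMulVec s s) - mI • (Matrix.vecMulVec r s + Matrix.vecMulVec s r)) *ᵥ x) < 0) ∧
     (∃ x : Fin 3 → ℝ, 0 < x ⬝ᵥ ((ℓ₀ • Matrix.vecMulVec v₀ v₀ + ℓ₁ • Matrix.vecMulVec v₁ v₁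
        + mR • (Matrix.vecMulVec r r - Matrix.vecMulVec s s) - mI • (Matrix.vecMulVec r s + Matrix.vecMulVec s r)) *ᵥ x))) ∧
    (¬ (ℓ₀ • Matrix.vecMulVec v₀ v₀ + ℓ₁ • Matrix.vecMulVec v₁ v₁
        + mR • (Matrix.vecMulVec r r - Matrix.vecMulVec s s) - mI • (Matrix.vecMulVec r s + Matrix.vecMulVec s r)).PosSemidef ∧
     ¬ (-(ℓ₀ • Matrix.vecMulVec v₀ v₀ + ℓ₁ • Matrix.vecMulVec v₁ v₁
        + mR • (Matrix.vecMulVec r r - Matrix.vecMulVec s s) - mI • (Matrix.vecMulVec r s + Matrix.vecMulVec s r))).PosSemidef) := by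
  refine not_posSemidef_of_testValues
    (![v₀ 1 * v₁ 2 - v₀ 2 * v₁ 1, v₀ 2 * v₁ 0 - v₀ 0 * v₁ 2, v₀ 0 * v₁ 1 - v₀ 1 * v₁ 0])
    (![r 1 * s 2 - r 2 * s 1, r 2 * s 0 - r 0 * s 2, r 0 * s 1 - r 1 * s 0])
    (Qn := mR * ((v₀ 0 * (v₁ 1 * r 2 - v₁ 2 * r 1) - v₀ 1 * (v₁ 0 * r 2 - v₁ 2 * r 0) + v₀ 2 * (v₁ 0 * r 1 - v₁ 1 * r 0)) ^ 2 - (v₀ 0 * (v₁ 1 * s 2 - v₁ 2 * s 1) - v₀ 1 * (v₁ 0 * s 2 - v₁ 2 * s 0) + v₀ 2 * (v₁ 0 * s 1 - v₁ 1 * s 0)) ^ 2) - 2 * mI * ((v₀ 0 * (v₁ 1 * r 2 - v₁ 2 * r 1) - v₀ 1 * (v₁ 0 * r 2 - v₁ 2 * r 0) + v₀ 2 * (v₁ 0 * r 1 - v₁ 1 * r 0)) * (v₀ 0 * (v₁ 1 * s 2 - v₁ 2 * s 1) - v₀ 1 * (v₁ 0 * s 2 - v₁ 2 * s 0) + v₀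 2 * (v₁ 0 * s 1 - v₁ 1 * s 0))))
    (Qz := ℓ₀ * (v₀ 0 * (r 1 * s 2 - r 2 * s 1) - v₀ 1 * (r 0 * s 2 - r 2 * s 0) + v₀ 2 * (r 0 * s 1 - r 1 * s 0)) ^ 2 + ℓ₁ * (v₁ 0 * (r 1 * s 2 - r 2 * s 1) - v₁ 1 * (r 0 * s 2 - r 2 * s 0) + v₁ 2 * (r 0 * s 1 - r 1 * s 0)) ^ 2) ?_ ?_
    (mul_neg_of_eq_of_neg_of_pos (a := ℓ₀ * ℓ₁) (c := mR ^ 2 + mI ^ 2) hℓ hm hz ?_)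
  · rw [quadForm_R2, dotProduct_cross_left, dotProduct_cross_right, dotProduct_cross_third, dotProduct_cross_third]
    ring
  · rw [quadForm_R2, dotProduct_cross_left, dotProduct_cross_right, dotProduct_cross_third, dotProduct_cross_third]
    ring
  · have h := det_R2_eq v₀ v₁ r s ℓ₀ ℓ₁ mR mI
    rw [hdet] at h; linarith

/-- **Class R2, two POSITIVE real nodes ⇒ SEMIDEFINITE type.**  With `ℓ₀, ℓ₁ > 0`, `m ≠ 0` and `ℓ₀ D₀² + ℓ₁ D₁² > 0` (not both
`det(vᵢ;r;s)` vanish), `det M = 0` forces `M ⪰ 0` (a `λ_min` crossing).  So in class R2 the TYPE of a root is the sign of `ℓ₀ℓ₁`. [folklore] -/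
theorem posSemidef_R2_of_pos_realNodes (v₀ v₁ r s : Fin 3 → ℝ) (ℓ₀ ℓ₁ mR mI : ℝ) (h₀ : 0 < ℓ₀) (h₁ : 0 < ℓ₁)
    (hm : 0 < mR ^ 2 + mI ^ 2)
    (hz : 0 < ℓ₀ * (v₀ 0 * (r 1 * s 2 - r 2 * s 1) - v₀ 1 * (r 0 * s 2 - r 2 * s 0) + v₀ 2 * (r 0 * s 1 - r 1 * s 0)) ^ 2
            + ℓ₁ * (v₁ 0 * (r 1 * s 2 - r 2 * s 1) - v₁ 1 * (r 0 * s 2 - r 2 * s 0) + v₁ 2 * (r 0 * s 1 - r 1 * s 0)) ^ 2)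
    (hdet : (ℓ₀ • Matrix.vecMulVec v₀ v₀ + ℓ₁ • Matrix.vecMulVec v₁ v₁
        + mR • (Matrix.vecMulVec r r - Matrix.vecMulVec s s) - mI • (Matrix.vecMulVec r s + Matrix.vecMulVec s r)).det = 0) :
    (ℓ₀ • Matrix.vecMulVec v₀ v₀ + ℓ₁ • Matrix.vecMulVec v₁ v₁
        + mR • (Matrix.vecMulVec r r - Matrix.vecMulVec s s) - mI • (Matrix.vecMulVec r s + Matrix.vecMulVec s r)).PosSemidef := by
  refine posSemidef_of_pairForm (isHermitian_R2 v₀ v₁ r s ℓ₀ ℓ₁ mR mI) v₀ v₁ r s ℓ₀ ℓ₁ mR mI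
    (quadForm_R2 v₀ v₁ r s ℓ₀ ℓ₁ mR mI) h₀ h₁ hm ?_ hdet
  by_contra hboth
  push Not at hboth
  rw [← cofactor_eq_det_rows, ← cofactor_eq_det_rows] at hboth
  rw [hboth.1, hboth.2] at hz
  norm_num at hz

/-- Negating all four node parameters negates the R2 matrix. [folklore] -/
theorem R2_neg (v₀ v₁ r s : Fin 3 → ℝ) (ℓ₀ ℓ₁ mR mI : ℝ) :
    ((-ℓ₀) • Matrix.vecMulVec v₀ v₀ + (-ℓ₁) • Matrix.vecMulVec v₁ v₁
        + (-mR) • (Matrix.vecMulVec r r - Matrix.vecMulVec s s) - (-mI) • (Matrix.vecMulVec r s + Matrix.vecMulVec s r))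
      = -(ℓ₀ • Matrix.vecMulVec v₀ v₀ + ℓ₁ • Matrix.vecMulVec v₁ v₁
        + mR • (Matrix.vecMulVec r r - Matrix.vecMulVec s s) - mI • (Matrix.vecMulVec r s + Matrix.vecMulVec s r)) := by
  simp only [neg_smul, sub_neg_eq_add]
  abel

/-- **Class R2, two NEGATIVE real nodes ⇒ `−M ⪰ 0` at a det-root** (a `λ_max` crossing). [folklore] -/
theorem neg_posSemidef_R2_of_neg_realNodes (v₀ v₁ r s : Fin 3 → ℝ) (ℓ₀ ℓ₁ mR mI : ℝ) (h₀ : ℓ₀ < 0) (h₁ : ℓ₁ < 0)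
    (hm : 0 < mR ^ 2 + mI ^ 2)
    (hz : ℓ₀ * (v₀ 0 * (r 1 * s 2 - r 2 * s 1) - v₀ 1 * (r 0 * s 2 - r 2 * s 0) + v₀ 2 * (r 0 * s 1 - r 1 * s 0)) ^ 2
            + ℓ₁ * (v₁ 0 * (r 1 * s 2 - r 2 * s 1) - v₁ 1 * (r 0 * s 2 - r 2 * s 0) + v₁ 2 * (r 0 * s 1 - r 1 * s 0)) ^ 2 < 0)
    (hdet : (ℓ₀ • Matrix.vecMulVec v₀ v₀ + ℓ₁ • Matrix.vecMulVec v₁ v₁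
        + mR • (Matrix.vecMulVec r r - Matrix.vecMulVec s s) - mI • (Matrix.vecMulVec r s + Matrix.vecMulVec s r)).det = 0) :
    (-(ℓ₀ • Matrix.vecMulVec v₀ v₀ + ℓ₁ • Matrix.vecMulVec v₁ v₁
        + mR • (Matrix.vecMulVec r r - Matrix.vecMulVec s s) - mI • (Matrix.vecMulVec r s + Matrix.vecMulVec s r))).PosSemidef := by
  rw [← R2_neg]
  refine posSemidef_R2_of_pos_realNodes v₀ v₁ r s (-ℓ₀) (-ℓ₁) (-mR) (-mI) (neg_pos.mpr h₀) (neg_pos.mpr h₁)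
    (by nlinarith) (by linarith) ?_
  rw [R2_neg, Matrix.det_neg, hdet, mul_zero]

/-! ## Class R0: two conjugate pairs -/

/-- **Quadratic form, class R0.** [folklore] -/
theorem quadForm_R0 (p q r s : Fin 3 → ℝ) (lR lI mR mI : ℝ) (x : Fin 3 → ℝ) :
    x ⬝ᵥ ((lR • (Matrix.vecMulVec p p - Matrix.vecMulVec q q) - lI • (Matrix.vecMulVec p q + Matrix.vecMulVec q p)
        + mR • (Matrix.vecMulVec r r - Matrix.vecMulVec s s) - mI • (Matrix.vecMulVec r s + Matrix.vecMulVec s r)) *ᵥ x)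
      = lR * ((p ⬝ᵥ x) ^ 2 - (q ⬝ᵥ x) ^ 2) - 2 * lI * ((p ⬝ᵥ x) * (q ⬝ᵥ x))
        + mR * ((r ⬝ᵥ x) ^ 2 - (s ⬝ᵥ x) ^ 2) - 2 * mI * ((r ⬝ᵥ x) * (s ⬝ᵥ x)) := by
  simp only [Matrix.mulVec, dotProduct, Matrix.add_apply, Matrix.sub_apply, Matrix.smul_apply, Matrix.vecMulVec_apply,
    smul_eq_mul, Fin.sum_univ_three]
  ring

/-- **The R0 determinant through the two test values**: with `z₁ = p × q`, `z₂ = r × s`,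
`det M = −(m_R² + m_I²)·Q(z₂) − (ℓ_R² + ℓ_I²)·Q(z₁)`, `Q(z₁) = m_R(D(p,q,r)² − D(p,q,s)²) − 2 m_I D(p,q,r) D(p,q,s)`,
`Q(z₂) = ℓ_R(D(r,s,p)² − D(r,s,q)²) − 2 ℓ_I D(r,s,p) D(r,s,q)` (`…NodeFormComplex.det_twoConjPairs` regrouped). [folklore] -/
theorem det_R0_eq (p q r s : Fin 3 → ℝ) (lR lI mR mI : ℝ) :
    (lR • (Matrix.vecMulVec p p - Matrix.vecMulVec q q) - lI • (Matrix.vecMulVec p q + Matrix.vecMulVec q p)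
        + mR • (Matrix.vecMulVec r r - Matrix.vecMulVec s s) - mI • (Matrix.vecMulVec r s + Matrix.vecMulVec s r)).det
      = -(mR ^ 2 + mI ^ 2) *
          (lR * ((r 0 * (s 1 * p 2 - s 2 * p 1) - r 1 * (s 0 * p 2 - s 2 * p 0) + r 2 * (s 0 * p 1 - s 1 * p 0)) ^ 2
                  - (r 0 * (s 1 * q 2 - s 2 * q 1) - r 1 * (s 0 * q 2 - s 2 * q 0) + r 2 * (s 0 * q 1 - s 1 * q 0)) ^ 2)
            - 2 * lI * ((r 0 * (s 1 * p 2 - s 2 * p 1) - r 1 * (s 0 * p 2 - s 2 * p 0) + r 2 * (s 0 * p 1 - s 1 * p 0))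
                  * (r 0 * (s 1 * q 2 - s 2 * q 1) - r 1 * (s 0 * q 2 - s 2 * q 0) + r 2 * (s 0 * q 1 - s 1 * q 0))))
        - (lR ^ 2 + lI ^ 2) *
          (mR * ((p 0 * (q 1 * r 2 - q 2 * r 1) - p 1 * (q 0 * r 2 - q 2 * r 0) + p 2 * (q 0 * r 1 - q 1 * r 0)) ^ 2
                  - (p 0 * (q 1 * s 2 - q 2 * s 1) - p 1 * (q 0 * s 2 - q 2 * s 0) + p 2 * (q 0 * s 1 - q 1 * s 0)) ^ 2)
            - 2 * mI * ((p 0 * (q 1 * r 2 - q 2 * r 1) - p 1 * (q 0 * r 2 - q 2 * r 0) + p 2 * (q 0 * r 1 - q 1 * r 0))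
                  * (p 0 * (q 1 * s 2 - q 2 * s 1) - p 1 * (q 0 * s 2 - q 2 * s 0) + p 2 * (q 0 * s 1 - q 1 * s 0)))) := by
  rw [Matrix.det_fin_three]
  simp only [Matrix.add_apply, Matrix.sub_apply, Matrix.smul_apply, Matrix.vecMulVec_apply, smul_eq_mul]
  ring

/-- **Class R0 ⇒ EVERY det-root is of INDEFINITE type.**  For `M = N(ℓ; p,q) + N(m; r,s)` (two real members of the spans of two
conjugate node pairs) with `ℓ, m ≠ 0` and the generic condition `Q(z₁) ≠ 0` at `z₁ = p × q`: if `det M = 0` then `xᵀMx` takes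
opposite strict signs at `z₁ = p × q` and `z₂ = r × s`, so neither `M` nor `−M` is positive semidefinite — along a class-R0 pencil
all roots are middle-eigenvalue crossings (census: 17/17 on both R0 seventeens). [folklore] -/
theorem indefinite_R0 (p q r s : Fin 3 → ℝ) (lR lI mR mI : ℝ) (hl : 0 < lR ^ 2 + lI ^ 2) (hm : 0 < mR ^ 2 + mI ^ 2)
    (hz₁ : mR * ((p 0 * (q 1 * r 2 - q 2 * r 1) - p 1 * (q 0 * r 2 - q 2 * r 0) + p 2 * (q 0 * r 1 - q 1 * r 0)) ^ 2
                  - (p 0 * (q 1 * s 2 - q 2 * s 1) - p 1 * (q 0 * s 2 - q 2 * s 0) + p 2 * (q 0 * s 1 - q 1 * s 0)) ^ 2)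
            - 2 * mI * ((p 0 * (q 1 * r 2 - q 2 * r 1) - p 1 * (q 0 * r 2 - q 2 * r 0) + p 2 * (q 0 * r 1 - q 1 * r 0))
                  * (p 0 * (q 1 * s 2 - q 2 * s 1) - p 1 * (q 0 * s 2 - q 2 * s 0) + p 2 * (q 0 * s 1 - q 1 * s 0))) ≠ 0)
    (hdet : (lR • (Matrix.vecMulVec p p - Matrix.vecMulVec q q) - lI • (Matrix.vecMulVec p q + Matrix.vecMulVec q p)
        + mR • (Matrix.vecMulVec r r - Matrix.vecMulVec s s) - mI • (Matrix.vecMulVec r s + Matrix.vecMulVec s r)).det = 0) :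
    ((∃ x : Fin 3 → ℝ, x ⬝ᵥ ((lR • (Matrix.vecMulVec p p - Matrix.vecMulVec q q) - lI • (Matrix.vecMulVec p q + Matrix.vecMulVec q p)
        + mR • (Matrix.vecMulVec r r - Matrix.vecMulVec s s) - mI • (Matrix.vecMulVec r s + Matrix.vecMulVec s r)) *ᵥ x) < 0) ∧
     (∃ x : Fin 3 → ℝ, 0 < x ⬝ᵥ ((lR • (Matrix.vecMulVec p p - Matrix.vecMulVec q q) - lI • (Matrix.vecMulVec p q + Matrix.vecMulVec q p)
        + mR • (Matrix.vecMulVec r r - Matrix.vecMulVec s s) - mI • (Matrix.vecMulVec r s + Matrix.vecMulVec s r)) *ᵥ x))) ∧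
    (¬ (lR • (Matrix.vecMulVec p p - Matrix.vecMulVec q q) - lI • (Matrix.vecMulVec p q + Matrix.vecMulVec q p)
        + mR • (Matrix.vecMulVec r r - Matrix.vecMulVec s s) - mI • (Matrix.vecMulVec r s + Matrix.vecMulVec s r)).PosSemidef ∧
     ¬ (-(lR • (Matrix.vecMulVec p p - Matrix.vecMulVec q q) - lI • (Matrix.vecMulVec p q + Matrix.vecMulVec q p)
        + mR • (Matrix.vecMulVec r r - Matrix.vecMulVec s s) - mI • (Matrix.vecMulVec r s + Matrix.vecMulVec s r))).PosSemidef) := by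
  -- test vectors z₂ = r × s (value −A-part, weight ℓ) in the role of `n`, z₁ = p × q in the role of `z`
  refine not_posSemidef_of_testValues
    (![r 1 * s 2 - r 2 * s 1, r 2 * s 0 - r 0 * s 2, r 0 * s 1 - r 1 * s 0])
    (![p 1 * q 2 - p 2 * q 1, p 2 * q 0 - p 0 * q 2, p 0 * q 1 - p 1 * q 0])
    (Qn := lR * ((r 0 * (s 1 * p 2 - s 2 * p 1) - r 1 * (s 0 * p 2 - s 2 * p 0) + r 2 * (s 0 * p 1 - s 1 * p 0)) ^ 2 - (r 0 * (s 1 * q 2 - s 2 * q 1) - r 1 * (s 0 * q 2 - s 2 * q 0) + r 2 * (s 0 * q 1 - s 1 * q 0)) ^ 2) - 2 * lI * ((r 0 * (s 1 * p 2 - s 2 * p 1) - r 1 * (s 0 * p 2 - s 2 * p 0) + r 2 * (s 0 * p 1 - s 1 * p 0)) * (r 0 * (s 1 * q 2 - s 2 * q 1) - r 1 * (s 0 * q 2 - s 2 * q 0) + r 2 * (s 0 * q 1 - s 1 * q 0))))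
    (Qz := mR * ((p 0 * (q 1 * r 2 - q 2 * r 1) - p 1 * (q 0 * r 2 - q 2 * r 0) + p 2 * (q 0 * r 1 - q 1 * r 0)) ^ 2 - (p 0 * (q 1 * s 2 - q 2 * s 1) - p 1 * (q 0 * s 2 - q 2 * s 0) + p 2 * (q 0 * s 1 - q 1 * s 0)) ^ 2) - 2 * mI * ((p 0 * (q 1 * r 2 - q 2 * r 1) - p 1 * (q 0 * r 2 - q 2 * r 0) + p 2 * (q 0 * r 1 - q 1 * r 0)) * (p 0 * (q 1 * s 2 - q 2 * s 1) - p 1 * (q 0 * s 2 - q 2 * s 0) + p 2 * (q 0 * s 1 - q 1 * s 0)))) ?_ ?_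
    (mul_neg_of_eq_of_neg_of_pos (a := -(mR ^ 2 + mI ^ 2)) (c := lR ^ 2 + lI ^ 2) (by linarith) hl hz₁ ?_)
  · rw [quadForm_R0, dotProduct_cross_left, dotProduct_cross_right, dotProduct_cross_third, dotProduct_cross_third]
    ring
  · rw [quadForm_R0, dotProduct_cross_left, dotProduct_cross_right, dotProduct_cross_third, dotProduct_cross_third]
    ring
  · have h := det_R0_eq p q r s lR lI mR mI
    rw [hdet] at h; linarith

end Summit.ValiantsHypothesis.ValiantsHypothesis.Theorems.LacunarySymmetroidMatrixDescartes.Census
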